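import Summits.BirchSwinnertonDyer.BirchSwinnertonDyer.Theses.LeadingTerm
import Summits.BirchSwinnertonDyer.BirchSwinnertonDyer.Theorems.PAdicOrderV2PadicBSDrankNoExcessOfMainConjecture
import Literature.NumberTheory.EllipticCurves.CyclotomicIwasawaMainTheoremIrreducible
import Literature.NumberTheory.EllipticCurves.ModPIrreducibleCofinite
import Literature.NumberTheory.EllipticCurves.PAdicBSD
import Literature.NumberTheory.EllipticCurves.IwasawaLeadingTerm
import Literature.NumberTheory.EllipticCurves.IwasawaSelmerDualProofs
import Literature.NumberTheory.EllipticCurves.SelmerInftyTorsionFiniteProofs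
import Literature.NumberTheory.EllipticCurves.KatoRankBoundProofs
import Literature.NumberTheory.EllipticCurves.CanonicalPAdicHeightHolds
import Literature.NumberTheory.EllipticCurves.BSDSha

/-!
# BirchSwinnertonDyer / LeadingTerm — crux `PinchPrime` (stmt-BirchSwinnertonDyer-16218),
# line `SketchIdeator2`, stub `stub_orderEqRankOfSchneiderShaAt` (GLUE, v6) and its corollaries

Registered stub of the lead skeleton `Cruxes/PinchPrime/Lines/SketchIdeator2.lean` (v6): the
HEIGHT-SIDE, POINTWISE form of the crux at an admissible prime. For an elliptic curve `E/ℚ`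
(globally minimal `W`) and a prime `p ≥ 5` of good ordinary reduction with `E[p]` irreducible,
if `Ш(E/ℚ)[p^∞]` is finite and the canonical cyclotomic `p`-adic height is non-degenerate
(`Reg_p(E, Dh) ≠ 0` for a canonical datum `Dh`, Schneider's conjecture at `p`), then for every
newform `f` of `E`, `ord_{T=0} L_p(f, α_p, T) = rank_ℤ E(ℚ)`.

The two deep inputs are HYPOTHESES (named tree facts, unproved in the tree):
* `Schneider1985_order_charGenerator` (Perrin-Riou–Schneider, as printed in
  Balakrishnan–Müller–Stein, Math. Comp. 85 (2016), Thm. 1.7): clause 2, `ord_{T=0} f_E = rank`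
  iff `Reg_p ≠ 0` and `Ш[p^∞]` finite, for `X(E/ℚ_∞)` finitely generated torsion with
  `char X = (f_E)`;
* `burungale_castella_skinner_charIdeal_eq_padicLFunction` (Burungale–Castella–Skinner, IMRN 2025,
  Thm. 1.1.2 (a)): for `p ≥ 5` good ordinary with `E[p]` irreducible, `X` is `Λ`-torsion and
  `char X = (g)` with `ι g = p^k · L_p(f, α_p, T)` in `ℚ_p⟦T⟧`.
Everything else is PROVED in the tree: the cyclotomic datum `(κ, γ)` with a normalised generator
(`exists_isCyclotomic_isTopGenerator_isCyclotomicVariable_holds`), the Iwasawa datum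
(`nonempty_selmerDualData_holds`) and its finite generation (`module_finite_of_isCyclotomic`),
`ord (ι g) = ord g` (`Theorems.order_iwasawaToPowerSeries`), `ord (p^k · L) = ord L`.

Corollaries (same hypotheses + modularity `exists_isNewformOf` for the `∃ f` of the crux):
* `PinchPrime_of_schneiderSha_somewhere` — the route's two-layer plan (c), glued: if every `E/ℚ`
  has ONE admissible prime (good ordinary `p ≥ 5`, `E[p]` irreducible) with `Ш[p^∞]` finite and
  a non-degenerate canonical height, then `LeadingTerm.PinchPrime`;
* `PinchPrime_of_standardConjectures` — `ShaFiniteConjecture` (Tate 1974, Conj. 1) and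
  Schneider's conjecture at every good ordinary `p ≥ 5` (Mazur–Stein–Tate 2006, Conj. 1.1, inline
  hypothesis) imply `LeadingTerm.PinchPrime`; the admissible prime is any good ordinary `p ≥ 5`
  with `E[p]` irreducible (`exists_gt_mem_goodOrdinaryPrimes_hasIrreducibleModPGaloisRep`:
  Serre/Deuring infinitude + Silverman AEC Cor. IX.6.3, both PROVED in the tree).
Compared with `Theorems/PinchPrime/Negative/ContentOfCrux.pinchPrime_of_schneiderShaSomewhere`
(refuter), the order-IMC is no longer asked at every good ordinary `p ≥ 5` (conjecture-strength
at residually reducible `p`) but taken from BCS at irreducible `p`, and the Iwasawa-datum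
hypothesis is discharged.
-/

noncomputable section

set_option linter.dupNamespace false

namespace Summit.BirchSwinnertonDyer.BirchSwinnertonDyer.Cruxes.PinchPrime.FirstLayerStability

open scoped MatrixGroups ModularForm
open CongruenceSubgroup Literature.NumberTheory.EllipticCurves
  Literature.NumberTheory.EllipticCurves.ModularForms
open Summit.BirchSwinnertonDyer.BirchSwinnertonDyer.Theses

/-- **`ord_{T=0} L_p = rank` at an admissible prime with finite `Ш[p^∞]` and non-degenerate
canonical height** (stub `stub_orderEqRankOfSchneiderShaAt` of crux `PinchPrime`, line
`SketchIdeator2`). Assume `Schneider1985_order_charGenerator` (BMS 2016 Thm. 1.7) and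
`burungale_castella_skinner_charIdeal_eq_padicLFunction` (BCS 2025 Thm. 1.1.2 (a)). Let `E/ℚ` be
elliptic with globally minimal `W`, `p ≥ 5` good ordinary with `E[p]` irreducible, `Ш(E/ℚ)[p^∞]`
finite, `Dh` a canonical height datum with `Reg_p(E, Dh) ≠ 0`, and `f` a newform of `E`. Then
`ord_{T=0} L_p(f, α_p, T) = rank_ℤ E(ℚ)`: with the cyclotomic datum `(κ, γ)` and the Iwasawa
datum `D` (tree theorems), BCS gives `X` torsion and `char X = (g)`, `ι g = p^k L_p`; PRS
clause 2 at `f_E := g` gives `ord g = rank`; and `ord L_p = ord (p^k L_p) = ord (ι g) = ord g`.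
[cite: BalakrishnanMullerStein2015, Thm. 1.7] [cite: BurungaleCastellaSkinner2025, Thm. 1.1.2 (a)] -/
theorem stub_orderEqRankOfSchneiderShaAt :
    Schneider1985_order_charGenerator → burungale_castella_skinner_charIdeal_eq_padicLFunction →
    ∀ (W : WeierstrassCurve ℚ) [W.IsElliptic] [W.IsGloballyMinimal] (p : ℕ) [Fact p.Prime],
      5 ≤ p → IsOrdinaryAt W p → W.HasIrreducibleModPGaloisRep p →
      Finite (AddCommGroup.primaryComponent W.sha p) →
      ∀ (Dh : WeierstrassCurve.PAdicHeightData W p), Dh.IsCanonical →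
        WeierstrassCurve.SchneiderConjecture Dh →
      ∀ {N : ℕ} [NeZero N] (f : CuspForm (Gamma0 N) 2), IsNewformOf W f →
        (padicLFunction f (unitRoot W p : ℚ_[p])).order = W.mordellWeilRank := by
  intro hPRS hBCS W _ _ p _ h5 hord hirr hsha Dh hDh hSch N _ f hf
  -- the cyclotomic datum and the Iwasawa datum (tree theorems)
  obtain ⟨κ, hκ, γ, hγ, hγ'⟩ := exists_isCyclotomic_isTopGenerator_isCyclotomicVariable_holds p
  obtain ⟨D⟩ := W.nonempty_selmerDualData_holds κ γ hγ
  haveI : Module.Finite (IwasawaAlgebra p) D.X := D.module_finite_of_isCyclotomic W κ hκ hγ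
  -- BCS at the irreducible prime `p`: `X` torsion, `char X = (g)`, `ι g = p^k · L_p`
  obtain ⟨hX, g, k, hg, hιg⟩ := hBCS W p κ γ f h5 hord.1 hord.2 hirr hκ hγ hγ' hf D
  -- PRS clause 2 at `f_E := g`: `ord g = rank`
  have horder : g.order = W.mordellWeilRank :=
    (Schneider1985_order_charGenerator.order_eq_iff hPRS h5 hord.1 hord.2 hκ hγ hγ' D hX hg
      hDh).mpr ⟨hSch, hsha⟩
  -- `ord L_p = ord (p^k · L_p) = ord (ι g) = ord g`
  have hpk : IsUnit (PowerSeries.C ((p : ℚ_[p]) ^ k)) := by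
    refine IsUnit.map PowerSeries.C (IsUnit.mk0 _ (zpow_ne_zero k ?_))
    exact_mod_cast (Fact.out : p.Prime).ne_zero
  have h2 : (iwasawaToPowerSeries p g).order =
      (padicLFunction f (unitRoot W p : ℚ_[p])).order := by
    rw [hιg, PowerSeries.order_mul, PowerSeries.order_zero_of_unit hpk, zero_add]
  rw [← h2, Summit.BirchSwinnertonDyer.BirchSwinnertonDyer.Theorems.order_iwasawaToPowerSeries, horder]

/-- **The route's two-layer plan (c), glued** (modulo PRS, modularity and BCS — hypotheses): if
every elliptic `E/ℚ` (globally minimal `W`) has ONE good ordinary prime `p ≥ 5` with `E[p]`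
irreducible at which `Ш(E/ℚ)[p^∞]` is finite AND the canonical cyclotomic `p`-adic height is
non-degenerate, then `LeadingTerm.PinchPrime` (the newform is `exists_isNewformOf`, the canonical
datum is the one given). [cite: BalakrishnanMullerStein2015, Thm. 1.7]
[cite: BurungaleCastellaSkinner2025, Thm. 1.1.2 (a)] -/
theorem PinchPrime_of_schneiderSha_somewhere
    (hPRS : Schneider1985_order_charGenerator) (hmod : exists_isNewformOf)
    (hBCS : burungale_castella_skinner_charIdeal_eq_padicLFunction)
    (h : ∀ (W : WeierstrassCurve ℚ) [W.IsElliptic] [W.IsGloballyMinimal],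
      ∃ (p : ℕ) (_ : Fact p.Prime), 5 ≤ p ∧ IsOrdinaryAt W p ∧ W.HasIrreducibleModPGaloisRep p ∧
        Finite (AddCommGroup.primaryComponent W.sha p) ∧
        ∃ Dh : WeierstrassCurve.PAdicHeightData W p,
          Dh.IsCanonical ∧ WeierstrassCurve.SchneiderConjecture Dh) :
    LeadingTerm.PinchPrime := by
  intro W _ _
  obtain ⟨p, hp, h5, hord, hirr, hsha, Dh, hDh, hSch⟩ := h W
  haveI : NeZero (W.conductorNorm ℤ) := ⟨(WeierstrassCurve.conductorNorm_pos_holds (W := W)).ne'⟩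
  obtain ⟨f, hf⟩ := hmod W
  exact ⟨p, hp, h5, hord, Dh, hDh, _, inferInstance, f, hf,
    stub_orderEqRankOfSchneiderShaAt hPRS hBCS W p h5 hord hirr hsha Dh hDh hSch f hf⟩

/-- **The standard conjectures imply the crux** (modulo PRS, modularity and BCS — hypotheses):
finiteness of `Ш(E/ℚ)` for every elliptic `E/ℚ` (`ShaFiniteConjecture`, Tate 1974 Conj. 1) and
non-degeneracy of the canonical cyclotomic `p`-adic height at every good ordinary `p ≥ 5`
(Schneider 1982, §1; Mazur–Stein–Tate 2006, Conj. 1.1 — an inline hypothesis, the tree has only the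
per-datum predicate `WeierstrassCurve.SchneiderConjecture`) give `LeadingTerm.PinchPrime`: take
any good ordinary `p ≥ 5` with `E[p]` irreducible
(`exists_gt_mem_goodOrdinaryPrimes_hasIrreducibleModPGaloisRep`) and its canonical datum
(`exists_isCanonical_holds`). [cite: MazurSteinTate2006, Conj. 1.1] [cite: Tate1974, Conj. 1] -/
theorem PinchPrime_of_standardConjectures
    (hPRS : Schneider1985_order_charGenerator) (hmod : exists_isNewformOf)
    (hBCS : burungale_castella_skinner_charIdeal_eq_padicLFunction)
    (hSha : ShaFiniteConjecture)
    (hSch : ∀ (W : WeierstrassCurve ℚ) [W.IsElliptic] [W.IsGloballyMinimal] (p : ℕ) [Fact p.Prime],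
      5 ≤ p → IsOrdinaryAt W p →
      ∀ Dh : WeierstrassCurve.PAdicHeightData W p, Dh.IsCanonical →
        WeierstrassCurve.SchneiderConjecture Dh) :
    LeadingTerm.PinchPrime := by
  refine PinchPrime_of_schneiderSha_somewhere hPRS hmod hBCS fun W _ _ ↦ ?_
  obtain ⟨p, hgt, ⟨hp, hgood, hnd⟩, hirr⟩ :=
    W.exists_gt_mem_goodOrdinaryPrimes_hasIrreducibleModPGaloisRep 4
  haveI : Fact p.Prime := hp
  haveI : Finite W.sha := hSha W ‹_›
  have h5 : 5 ≤ p := by omega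
  obtain ⟨Dh, hDh⟩ := WeierstrassCurve.exists_isCanonical_holds W p h5 hgood hnd
  exact ⟨p, hp, h5, ⟨hgood, hnd⟩, hirr, inferInstance, Dh, hDh, hSch W p h5 ⟨hgood, hnd⟩ Dh hDh⟩

end Summit.BirchSwinnertonDyer.BirchSwinnertonDyer.Cruxes.PinchPrime.FirstLayerStability

end
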